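import Mathlib.RingTheory.Polynomial.Cyclotomic.Basic
import Literature.NumberTheory.EllipticCurves.PAdicPowerSeriesZeros
import HarnessLib

/-!
# Pollack's plus/minus `p`-adic `L`-functions of an elliptic curve at a supersingular prime with `a_p = 0`

R. Pollack, *On the `p`-adic `L`-function of a modular form at a supersingular prime*, Duke Math.
J. 118 (2003), 523–558 [Pollack2003], attaches to an elliptic curve `E/ℚ` and an odd prime `p` of
good reduction with `a_p = 0` two **Iwasawa functions** `L_p^+(E, T), L_p^-(E, T) ∈ ℤ_p⟦T⟧`
(Thm. 5.6: `L_p(E, α, T) = L_p^+ · log_p^+ + L_p^- · log_p^- · α`, with the half-logarithms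
`log_p^+ = p⁻¹ ∏_{n ≥ 1} Φ_{p^{2n}}(1+T)/p`, `log_p^- = p⁻¹ ∏_{n ≥ 1} Φ_{p^{2n-1}}(1+T)/p` of
Lemma 4.1 / Cor. 4.2), both non-zero (Cor. 5.11, from Rohrlich's theorem), and relates them to
the **modular elements of Mazur–Tate** `θ_n(T) = ∑_{a ∈ (ℤ/p^{n+1})^×} [a/p^{n+1}]⁺ (1+T)^{ℓ(a)}`
(Def. 6.15) by the congruences of Prop. 6.18:
`θ_n ≡ ω_n^- · L_p^- (mod ω_n)` for `n` even, `θ_n ≡ ω_n^+ · L_p^+ (mod ω_n)` for `n` odd, where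
`ω_n = (1+T)^{p^n} - 1`, `ω_n^+ = ∏_{1 ≤ 2k ≤ n} Φ_{p^{2k}}(1+T)`, `ω_n^- = ∏_{1 ≤ 2k-1 ≤ n} Φ_{p^{2k-1}}(1+T)`
(so `T ω_n^+ ω_n^- = ω_n`).

## What is vendored, and in which form

The tree has no `p`-adic `L`-function `L_p(E, α, T)` at a *supersingular* prime (the roots `α`
of `X² + p` are not in `ℚ_p` and `μ_{f,α}` is an unbounded, `1/2`-admissible distribution; see the
design notes of `PAdicLFunction.lean`, which defer Pollack's `L_p^±` "to a later item" — this is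
that item, `wi-36842`). We therefore vendor Pollack's theorem in the *intrinsic* form printed as
Prop. 6.18 + Thm. 5.6 + Cor. 5.11, which involves only objects the tree has:

* `mazurTateElement f p n ∈ ℚ[T]` — Pollack's `θ_n` (Def. 6.15; Mazur–Tate 1987), written, as the
  tree's Riemann sums `padicLRiemannSum` are, through the Teichmüller parametrisation
  `a = η γ^s` of `(ℤ/p^{n+e₀})^×` (`η ∈ μ_τ(ℤ_p)`, `s mod p^n`, `γ = cyclotomicGenerator p = 1 + p^{e₀}`,
  `e₀ = 1` for odd `p`): `θ_n = ∑_η ∑_{s mod p^n} [η γ^s / p^{n+e₀}]⁺_f (1 + T)^s`, a polynomial of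
  degree `< p^n`, i.e. the canonical lift of the group-ring element
  `∑_a [a/p^{n+1}]⁺ σ_a|_{ℚ_n} ∈ ℚ[Gal(ℚ_n/ℚ)] = ℚ[T]/(ω_n)` (Pollack, Remark 6.16) under
  `γ ↦ 1 + T`; here `[r]⁺_f = ratPlusSymbol f r` is the tree's rational plus modular symbol
  (period `Ω⁺_f` of the newform, `[0]⁺ = L(f,1)/Ω⁺_f`, MTT conventions);
* `cyclotomicOmega p n = ω_n`, `cyclotomicOmegaPlus p n = ω_n^+`, `cyclotomicOmegaMinus p n = ω_n^-`
  in `ℤ[T]` (API: `X_mul_cyclotomicOmegaPlus_mul_cyclotomicOmegaMinus`, `T ω_n^+ ω_n^- = ω_n`);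
* `IsCongrModOmega p n θ ω L` — "`θ ≡ ω · L (mod ω_n)` in `Λ ⊗ ℚ_p`" (`Λ = ℤ_p⟦T⟧ =
  IwasawaAlgebra p`, embedded in `ℚ_p⟦T⟧` by `iwasawaToPowerSeries`): some `p^m (θ - ω L)` lies in
  `ω_n · Λ`;
* the NAMED FACT `pollack_exists_plusMinusPAdicLFunction` (D-0014): for `p` odd, `f` the newform
  of `E = W` (`IsNewformOf W f`), `E` with good reduction at `p` and `a_p(E) = 0`, there exist
  `L⁺, L⁻ ∈ Λ`, both `≠ 0`, with `θ_n ≡ (-1)^{⌊n/2⌋+1} ω_n^+ L⁺ (mod ω_n)` for all odd `n` and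
  `θ_n ≡ (-1)^{⌊n/2⌋+1} ω_n^- L⁻ (mod ω_n)` for all even `n`.

Since `ω_n` is a distinguished polynomial with the simple roots `ζ - 1`, `ζ ∈ μ_{p^n}`, a
congruence mod `ω_n` in `Λ ⊗ ℚ_p` gives equality of values at these points of the open unit disc
of `ℂ_p` (PROVED: `IsCongrModOmega.eval₂_eq`); at `T = χ(γ) - 1` for `χ` a wild character of
conductor `p^{n+1}` the value of `θ_n` is Birch's twisted symbol sum
`∑_a χ(a) [a/p^{n+1}]⁺ = τ(χ) L(E, χ̄, 1)/Ω⁺` (PROVED: `eval₂_mazurTateElement_eq_ratTwistedSymbolSum`;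
`ratTwistedSymbolSum_mul_plusPeriod` for Birch's formula), and `ω_n^±(ζ_n - 1) ≠ 0` for the parity
used (Lemma 4.7; PROVED: `eval₂_cyclotomicOmegaPlus_ne_zero`, `eval₂_cyclotomicOmegaMinus_ne_zero`),
so the congruences yield the interpolation property of `L_p^±` at all wild characters (Pollack,
proof of Prop. 6.9; PROVED from the fact: `pollack_exists_plusMinusPAdicLFunction.interpolation`),
and they determine `L^±` inside `Λ ⊗ ℚ_p` (an element of `Λ ⊗ ℚ_p` with infinitely many zeros in
the open disc vanishes, `MemIwasawaRat.finite_setOf_hasSum_zero`). Consequently a vanishing Birch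
sum at a wild character of conductor `p^{n+1}` is a zero `χ(γ) - 1` of `L⁺` (`n` odd) or `L⁻`
(`n` even) (PROVED: `pollack_exists_plusMinusPAdicLFunction.hasSum_zero_of_ratTwistedSymbolSum_eq_zero`),
and only finitely many levels `n` carry such a character (PROVED:
`pollack_exists_plusMinusPAdicLFunction.finite_setOf_exists_ratTwistedSymbolSum_eq_zero`; Pollack,
Cor. 5.11 with §3). The `λ`- and `μ`-invariants `λ^±, μ^±` of Def. 6.1 are those of the
`Λ`-elements `L^±` (Weierstrass preparation, `IwasawaAlgebra`).

## The sign in Prop. 6.18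

Pollack prints Prop. 6.18 without the sign `(-1)^{⌊n/2⌋+1}`; his proof ("`θ_n = p^{(n+1)/2} G⁺_{n+1}`")
drops the sign of the factor `(-p)^{-(n+1)/2}` of his own Lemma 5.9, and the result is used in
[Pollack2003] only through the ideal `(ω_n, ω_n^+ L^+, ω_n^- L^-)` (p. 555), where signs are
immaterial. As an identity the sign is forced to alternate with `n ↦ n + 2`: evaluating the
level-`n` and level-`(n-2)` congruences at a primitive `p^{n-2}`-th root of unity `ζ` and using the
distribution relation with `a_p = 0`, `θ_n(ζ - 1) = -p · θ_{n-2}(ζ - 1)`, against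
`ω_n^±(ζ - 1) = p · ω_{n-2}^±(ζ - 1)`, gives opposite signs whenever `θ_{n-2}(ζ - 1) ≠ 0` (which
happens, by Rohrlich). With Pollack's conventions (`μ_{f,α}(a + p^nℤ_p) = α⁻ⁿ[a/pⁿ]⁺ - α⁻ⁿ⁻¹[a/pⁿ⁻¹]⁺`,
`G⁻ = (L_p(α) - L_p(ᾱ))/(2α)`, `L^± = G^±/log_p^±`, Lemma 4.7 for `log_p^±(ζ_n - 1)`) a direct
evaluation gives `θ_n(ζ_n - 1) = (-1)^{⌊n/2⌋+1} ω_n^±(ζ_n - 1) L^±(ζ_n - 1)` (e.g. `L⁻(0) = -θ_0`,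
`L⁺(0) = (p-1)[0]⁺`), which is the sign recorded here; the overall signs of `L⁺` and of `L⁻` are in
any case conventions absorbed by the existential quantifier, only the alternation in `n` is not.

## Normalisations and scope (deliberately NOT here)

* Periods: Pollack's `[a/m]⁺` is normalised by the Néron period `Ω_E` (§5.2.1), the tree's
  `ratPlusSymbol` by `Ω⁺_f`; for the optimal curve these differ by the Manin constant, an integer
  (Edixhoven) and a `p`-adic unit at a supersingular `p` (Pollack, Remark 5.5, from Mazur 1978 and
  Abbes–Ullmo 1996), so integrality, non-vanishing and the congruences are unaffected.
* Only the trivial tame character: Thm. 5.1 of [Pollack2003] treats `L_p(f, α, ψ, T)` for tame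
  characters `ψ` of conductor `M` PRIME TO `p` (and weight `k ≥ 2`), in `Λ_ψ ⊗ K_ψ` (bounded, not
  integral); the branches `ω^i`, `i ≠ 0`, of the Teichmüller character are not covered by the
  printed theorems and are not vendored. TODO(general form): tame twists of conductor prime to `p`
  once the tree has twisted modular-symbol measures.
* `p = 2` (parity switch and an extra factor `1/2`, Thm. 5.6) is excluded, as in Prop. 6.18.
* Not vendored: the half-logarithms `log_p^±` and Thm. 5.6 in the form `L_p(E,α,T) = …` (no
  supersingular `L_p(E, α, T)` in the tree), the functional equation (Thm. 5.13), Kato's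
  divisibility `L^{alg,±} ∣ L^{an,±}` (Cor. 5.18), Kobayashi's `±`-Selmer groups, and the
  conjectures 5.15, 6.3, 6.19.
  READING NOTE (added 2026-08-28, doc-only; no declaration touched): Pollack's functional equation,
  Thm. 5.13, is stated in print WITHOUT the unit factors `W^±(1+T)` and is "off by a unit factor"
  (F. Sprung, ANT 11 (2017), §1 = arXiv:1601.00010 p. 5, and Cor. 4.14; arXiv:1211.1352 Cor. 3.17 and its note on [Pollack,
  Thm. 5.13]); the CORRECTED functional equation of the pair at `a_p = 0` (trivial tame character) is
  vendored, in the tree's `(L♯, L♭) = (L⁺, L⁻)`-at-`a_p = 0` currency, as the named fact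
  `Sprung2017.cor414_sharpFlat_functionalEquation_apZero` (`Sprung2017/SharpFlatFunctionalEquation.lean`,
  odd `p`; proved ideal-currency corollary `….span_eq`) and, for `p = 2`, as the THEOREM
  `Literature.Barriers.BirchSwinnertonDyer.subst_invOnePlusSubOne_eq_of_isSprungPair_two`. Thm. 5.13 itself
  is therefore deliberately NOT vendored.

## References

* R. Pollack, *On the `p`-adic `L`-function of a modular form at a supersingular prime*, Duke
  Math. J. 118 (2003), no. 3, 523–558: Lemma 4.1, Cor. 4.2, Lemma 4.7, Thm. 5.1, Thm. 5.6,
  Lemma 5.9, Cor. 5.11, Def. 6.1, Def. 6.15, Prop. 6.18 [Pollack2003].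
* B. Mazur, J. Tate, *Refined conjectures of the "Birch and Swinnerton-Dyer type"*, Duke Math. J.
  54 (1987), 711–750 (modular elements).
* B. Mazur, J. Tate, J. Teitelbaum, Invent. Math. 84 (1986), §I.4 (4.2), §I.8, §I.10, §I.13
  [MazurTateTeitelbaum1986Invent].
-/

noncomputable section

open scoped MatrixGroups ModularForm

open CongruenceSubgroup Polynomial Literature.NumberTheory.EllipticCurves.ModularForms

namespace Literature.NumberTheory.EllipticCurves

/-! ### The polynomials `ω_n`, `ω_n^+`, `ω_n^-` -/

section Omega

variable (p : ℕ)

/-- `ω_n(T) = (1 + T)^{p^n} - 1 ∈ ℤ[T]`, the distinguished polynomial whose roots are the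
`ζ - 1`, `ζ ∈ μ_{p^n}`; `Λ/ω_n Λ = ℤ_p[Gal(ℚ_n/ℚ)]` under `1 + T ↔ γ` (Pollack 2003, Thm. 6.17,
"`ω_n = (1+T)^{p^n} - 1`"). [cite: Pollack2003, Thm. 6.17] -/
def cyclotomicOmega (n : ℕ) : ℤ[X] :=
  (X + 1) ^ p ^ n - 1

/-- `ω_n^+(T) = ∏_{1 ≤ 2k ≤ n} Φ_{p^{2k}}(1 + T) ∈ ℤ[T]` (`Φ_m` the `m`-th cyclotomic polynomial):
the even-index half of `ω_n/T = ∏_{1 ≤ j ≤ n} Φ_{p^j}(1+T)` (Pollack 2003, display before Prop. 6.18).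
Its roots are the `ζ - 1` with `ζ` of order `p^{2k}`, `2k ≤ n`. [cite: Pollack2003, §6.5 (display before Prop. 6.18)] -/
def cyclotomicOmegaPlus (n : ℕ) : ℤ[X] :=
  ∏ k ∈ Finset.Icc 1 (n / 2), (cyclotomic (p ^ (2 * k)) ℤ).comp (X + 1)

/-- `ω_n^-(T) = ∏_{1 ≤ 2k-1 ≤ n} Φ_{p^{2k-1}}(1 + T) ∈ ℤ[T]`: the odd-index half of
`ω_n/T = ∏_{1 ≤ j ≤ n} Φ_{p^j}(1+T)` (Pollack 2003, display before Prop. 6.18). Its roots are the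
`ζ - 1` with `ζ` of order `p^{2k-1}`, `2k - 1 ≤ n`. [cite: Pollack2003, §6.5 (display before Prop. 6.18)] -/
def cyclotomicOmegaMinus (n : ℕ) : ℤ[X] :=
  ∏ k ∈ Finset.Icc 1 ((n + 1) / 2), (cyclotomic (p ^ (2 * k - 1)) ℤ).comp (X + 1)

/-- `ω_0^+ = 1` (empty product). [cite: Pollack2003, §6.5 (display before Prop. 6.18)] -/
@[simp] theorem cyclotomicOmegaPlus_zero : cyclotomicOmegaPlus p 0 = 1 := by
  simp [cyclotomicOmegaPlus]

/-- `ω_0^- = 1` (empty product). [cite: Pollack2003, §6.5 (display before Prop. 6.18)] -/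
@[simp] theorem cyclotomicOmegaMinus_zero : cyclotomicOmegaMinus p 0 = 1 := by
  simp [cyclotomicOmegaMinus]

/-- Passing from `n` to `n + 1` multiplies `ω_n^+ ω_n^-` by `Φ_{p^{n+1}}(1 + T)` (the new factor
joins `ω^+` if `n + 1` is even and `ω^-` if `n + 1` is odd). [folklore] -/
theorem cyclotomicOmegaPlus_mul_cyclotomicOmegaMinus_succ (n : ℕ) :
    cyclotomicOmegaPlus p (n + 1) * cyclotomicOmegaMinus p (n + 1) =
      cyclotomicOmegaPlus p n * cyclotomicOmegaMinus p n *
        (cyclotomic (p ^ (n + 1)) ℤ).comp (X + 1) := by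
  rcases Nat.even_or_odd n with ⟨k, rfl⟩ | ⟨k, rfl⟩
  · -- `n = 2k`, `n + 1 = 2k + 1` odd: `ω^+` unchanged, `ω^-` gains `Φ_{p^{2(k+1)-1}}`
    have h1 : (k + k + 1) / 2 = k := by omega
    have h2 : (k + k) / 2 = k := by omega
    have h3 : (k + k + 1 + 1) / 2 = k + 1 := by omega
    have h4 : (k + k + 1) = 2 * (k + 1) - 1 := by omega
    simp only [cyclotomicOmegaPlus, cyclotomicOmegaMinus, h1, h2, h3]
    rw [Finset.prod_Icc_succ_top (Nat.le_add_left 1 k), ← h4]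
    ring
  · -- `n = 2k + 1`, `n + 1 = 2(k + 1)` even: `ω^-` unchanged, `ω^+` gains `Φ_{p^{2(k+1)}}`
    have h1 : (2 * k + 1 + 1) / 2 = k + 1 := by omega
    have h2 : (2 * k + 1) / 2 = k := by omega
    have h3 : (2 * k + 1 + 1 + 1) / 2 = k + 1 := by omega
    have h4 : 2 * k + 1 + 1 = 2 * (k + 1) := by omega
    simp only [cyclotomicOmegaPlus, cyclotomicOmegaMinus, h1, h2, h3]
    rw [Finset.prod_Icc_succ_top (Nat.le_add_left 1 k), h4]
    ring

/-- **`T · ω_n^+ · ω_n^- = ω_n`** (Pollack 2003, before Prop. 6.18: "Note that `T ω_n^+ ω_n^- = ω_n`"):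
`∏_{0 ≤ j ≤ n} Φ_{p^j}(X) = X^{p^n} - 1` (Mathlib `cyclotomic_prime_pow_mul_X_pow_sub_one`) at
`X = 1 + T`. [cite: Pollack2003, §6.5 (display before Prop. 6.18)] -/
theorem X_mul_cyclotomicOmegaPlus_mul_cyclotomicOmegaMinus [hp : Fact p.Prime] (n : ℕ) :
    X * cyclotomicOmegaPlus p n * cyclotomicOmegaMinus p n = cyclotomicOmega p n := by
  induction n with
  | zero => simp [cyclotomicOmega]
  | succ n ih =>
    rw [mul_assoc, cyclotomicOmegaPlus_mul_cyclotomicOmegaMinus_succ, ← mul_assoc, ← mul_assoc,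
      ih, cyclotomicOmega, cyclotomicOmega]
    have h := congr_arg (fun q : ℤ[X] ↦ q.comp (X + 1))
      (cyclotomic_prime_pow_mul_X_pow_sub_one ℤ p n)
    simp only [mul_comp, sub_comp, pow_comp, X_comp, one_comp] at h
    rw [mul_comm] at h
    exact h

end Omega

/-! ### Mazur–Tate modular elements `θ_n` -/

section MazurTate

variable {N : ℕ} (f : CuspForm (Gamma0 N) 2) (p : ℕ) [Fact p.Prime]

/-- The **modular element of Mazur and Tate** `θ_n(f, T) ∈ ℚ[T]` at the `n`-th layer of the
cyclotomic `ℤ_p`-extension, in the variable `1 + T ↔ γ = cyclotomicGenerator p = 1 + p^{e₀}`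
(Pollack 2003, Def. 6.15: `θ_n(T) = ∑_{a ∈ (ℤ/p^{n+1})^×} [a/p^{n+1}] (1+T)^{log_p(a)/log_p(γ)}`,
read in `ℚ[Gal(ℚ_n/ℚ)] = ℚ[T]/(ω_n)`, Remark 6.16). Writing the units modulo `p^{n+e₀}` uniquely as
`a = η γ^s`, `η` a Teichmüller representative (`rootsOfUnity (torsionOrder p) ℤ_[p]`), `s mod p^n`
(`classMap_injective`, `finsum_sum_classes_eq_sum_units`), the restriction of `σ_a` to `ℚ_n` is
`γ^s`, so `θ_n = ∑_η ∑_{s mod p^n} [η γ^s / p^{n+e₀}]⁺_f (1 + T)^s` with `s` represented in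
`[0, p^n)`: a polynomial of degree `< p^n`, the canonical representative modulo
`ω_n = (1+T)^{p^n} - 1`. Here `[r]⁺_f = ratPlusSymbol f r ∈ ℚ` (tree conventions, period `Ω⁺_f`),
and for odd `p` (`e₀ = 1`, `μ_τ = μ_{p-1}`) the level is `p^{n+1}` as printed; for `p = 2` this is
the analogous element at level `2^{n+2}` (tree convention `Γ = 1 + 4ℤ_2`), not used below.
[cite: Pollack2003, Def. 6.15] -/
def mazurTateElement (n : ℕ) : ℚ[X] :=
  ∑ᶠ η : rootsOfUnity (torsionOrder p) ℤ_[p], ∑ s : ZMod (p ^ n),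
    C (ratPlusSymbol f
        (((PadicInt.toZModPow (n + cyclotomicExponent p) ((η : ℤ_[p]ˣ) : ℤ_[p]) *
              (cyclotomicGenerator p : ZMod (p ^ (n + cyclotomicExponent p))) ^ s.val).val : ℚ) /
          (p : ℚ) ^ (n + cyclotomicExponent p))) *
      (X + 1) ^ s.val

/-- `θ ≡ ω · L (mod ω_n)` **in `Λ ⊗ ℚ_p`**, for `θ ∈ ℚ[T]`, `ω ∈ ℤ[T]` and `L ∈ Λ = ℤ_p⟦T⟧`: there
are `m ≥ 0` and `q ∈ Λ` with `p^m · (θ - ω · L) = ω_n · q` in `ℚ_p⟦T⟧` (`Λ ↪ ℚ_p⟦T⟧` by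
`iwasawaToPowerSeries`; `Λ ⊗ ℚ_p = Λ[1/p]`, `MemIwasawaRat`). Since `ω_n` is distinguished with
simple roots, this says that `θ` and `ω L` take the same value at every `ζ - 1`, `ζ ∈ μ_{p^n}`,
in `ℂ_p` (Weierstrass division; Lazard). The shape of the congruences of Pollack 2003, Prop. 6.18.
[cite: Pollack2003, Prop. 6.18] -/
def IsCongrModOmega (n : ℕ) (θ : ℚ[X]) (ω : ℤ[X]) (L : IwasawaAlgebra p) : Prop :=
  ∃ (m : ℕ) (q : IwasawaAlgebra p),
    PowerSeries.C ((p : ℚ_[p]) ^ m) *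
        ((θ.map (algebraMap ℚ ℚ_[p]) : PowerSeries ℚ_[p]) -
          iwasawaToPowerSeries p ((ω.map (Int.castRingHom ℤ_[p]) : PowerSeries ℤ_[p]) * L)) =
      iwasawaToPowerSeries p
        (((cyclotomicOmega p n).map (Int.castRingHom ℤ_[p]) : PowerSeries ℤ_[p]) * q)

/-- Unfolding lemma for `IsCongrModOmega`. [cite: Pollack2003, Prop. 6.18] -/
theorem isCongrModOmega_iff (n : ℕ) (θ : ℚ[X]) (ω : ℤ[X]) (L : IwasawaAlgebra p) :
    IsCongrModOmega p n θ ω L ↔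
      ∃ (m : ℕ) (q : IwasawaAlgebra p),
        PowerSeries.C ((p : ℚ_[p]) ^ m) *
            ((θ.map (algebraMap ℚ ℚ_[p]) : PowerSeries ℚ_[p]) -
              iwasawaToPowerSeries p ((ω.map (Int.castRingHom ℤ_[p]) : PowerSeries ℤ_[p]) * L)) =
          iwasawaToPowerSeries p
            (((cyclotomicOmega p n).map (Int.castRingHom ℤ_[p]) : PowerSeries ℤ_[p]) * q) :=
  Iff.rfl

end MazurTate

/-! ### Pollack's theorem -/

section Pollack

variable {W : WeierstrassCurve ℚ} [W.IsElliptic] [W.IsGloballyMinimal] {N : ℕ} [NeZero N]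
  {f : CuspForm (Gamma0 N) 2} {p : ℕ} [Fact p.Prime]

/-- **Pollack's plus/minus `p`-adic `L`-functions** (Pollack 2003, Thm. 5.6, Cor. 5.11, Prop. 6.18).
Let `p` be an odd prime, `E = W/ℚ` an elliptic curve with good reduction at `p` and `a_p(E) = 0`
(so `p` is supersingular; automatic for supersingular `p > 3`), and `f` the newform of `E`
(`IsNewformOf W f`). Then there are two Iwasawa functions `L⁺ = L_p^+(E, T)`, `L⁻ = L_p^-(E, T)`
in `Λ = ℤ_p⟦T⟧` (Thm. 5.6: "`L_p(E, α, T) = L_p^+(E,T) · log_p^+(T) + L_p^-(E,T) · log_p^-(T) · α`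
with `L_p^+(E,T), L_p^-(E,T) ∈ ℤ_p⟦T⟧`"), both non-zero (Cor. 5.11: "`L_p(E,α,T)`, `L_p^+(E,T)`, and
`L_p^-(E,T)` are all nonzero functions", from Rohrlich's theorem 5.10), such that the Mazur–Tate
elements satisfy (Prop. 6.18: "`θ_n ≡ ω_n^- · L_p^{an,-} (mod ω_n)`, `2 ∣ n`;
`θ_n ≡ ω_n^+ · L_p^{an,+} (mod ω_n)`, `2 ∤ n`", congruences in `Λ ⊗ ℚ_p`)
`θ_n ≡ (-1)^{⌊n/2⌋+1} ω_n^+ L⁺ (mod ω_n)` for every odd `n` and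
`θ_n ≡ (-1)^{⌊n/2⌋+1} ω_n^- L⁻ (mod ω_n)` for every even `n ≥ 0`.
The sign `(-1)^{⌊n/2⌋+1}`, not printed in Prop. 6.18 (whose proof drops the sign of `(-p)^{-(n+1)/2}`
in Lemma 5.9, and which [Pollack2003] only uses up to units), is forced by the distribution relation
and fixed by Pollack's conventions — see the module docstring; the overall signs of `L⁺`, `L⁻` are
absorbed by the existential. Evaluated at `T = χ(γ) - 1` for `χ` a wild character of conductor
`p^{n+1}` (`θ_n(χ(γ) - 1) = ∑_a χ(a)[a/p^{n+1}]⁺ = τ(χ) L(E, χ̄, 1)/Ω⁺`, Birch; `ω_n^±(ζ_n - 1) ≠ 0`,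
Lemma 4.7) these congruences are the interpolation property of `L_p^±` (proof of Prop. 6.9) and
determine `L^±` in `Λ ⊗ ℚ_p`. Tree normalisation of `[·]⁺` by `Ω⁺_f` (differs from Pollack's `Ω_E`
by the Manin constant, a `p`-adic unit here, Remark 5.5). [cite: Pollack2003, Thm. 5.6, Cor. 5.11 and Prop. 6.18] -/
def pollack_exists_plusMinusPAdicLFunction : Prop :=
  ∀ (_ : p ≠ 2) (_ : IsNewformOf W f) (_ : W.HasGoodReductionAtPrime p)
    (_ : W.frobeniusTrace p = 0),
    ∃ Lplus Lminus : IwasawaAlgebra p, Lplus ≠ 0 ∧ Lminus ≠ 0 ∧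
      (∀ n : ℕ, Odd n →
        IsCongrModOmega p n (mazurTateElement f p n)
          ((-1) ^ (n / 2 + 1) * cyclotomicOmegaPlus p n) Lplus) ∧
      (∀ n : ℕ, Even n →
        IsCongrModOmega p n (mazurTateElement f p n)
          ((-1) ^ (n / 2 + 1) * cyclotomicOmegaMinus p n) Lminus)

end Pollack

/-! ### Evaluating the congruences: the interpolation property of `L^±` -/

section Evaluation

variable {p : ℕ} [Fact p.Prime]

/-- **A congruence mod `ω_n` in `Λ ⊗ ℚ_p` is an equality of values at the `ζ - 1`, `ζ ∈ μ_{p^n}`**: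
if `θ ≡ ω L (mod ω_n)` then `θ(z) = ω(z) · L(z)` in `ℂ_p` for every `z` with `|z| < 1` and
`(1 + z)^{p^n} = 1`, where `L(z) = ∑_k l_k z^k` (evaluate `p^m (θ - ω L) = ω_n q` at `z`:
evaluation of bounded power series on the open unit disc is additive and multiplicative,
`tsum_map_coeff_mul_mul_pow`, and `ω_n(z) = 0`) (Pollack 2003, proof of Prop. 6.18).
[cite: Pollack2003, Prop. 6.18 (proof)] -/
theorem IsCongrModOmega.eval₂_eq {n : ℕ} {θ : ℚ[X]} {ω : ℤ[X]} {L : IwasawaAlgebra p}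
    (h : IsCongrModOmega p n θ ω L) {z : ℂ_[p]} (hz : ‖z‖ < 1) (hzn : (1 + z) ^ p ^ n = 1) :
    θ.eval₂ (algebraMap ℚ ℂ_[p]) z =
      ω.eval₂ (algebraMap ℤ ℂ_[p]) z *
        ∑' k, ((algebraMap ℚ_[p] ℂ_[p]).comp (algebraMap ℤ_[p] ℚ_[p]))
          (PowerSeries.coeff k L) * z ^ k := by
  classical
  obtain ⟨m, q, hmq⟩ := h
  set ι : ℚ_[p] →+* ℂ_[p] := algebraMap ℚ_[p] ℂ_[p] with hι
  set ιZ : ℤ_[p] →+* ℂ_[p] := (algebraMap ℚ_[p] ℂ_[p]).comp (algebraMap ℤ_[p] ℚ_[p]) with hιZ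
  have hbd : ∀ (A : PowerSeries ℤ_[p]) (k : ℕ), ‖ιZ (PowerSeries.coeff k A)‖ ≤ 1 :=
    norm_algebraMap_coeff_le_one
  -- coefficients of `ι_Λ(G)` are those of `G`
  have hcoe : ∀ (G : IwasawaAlgebra p) (k : ℕ),
      ι (PowerSeries.coeff k (iwasawaToPowerSeries p G)) = ιZ (PowerSeries.coeff k G) := by
    intro G k
    simp only [hι, hιZ, RingHom.comp_apply, iwasawaToPowerSeries, PowerSeries.coeff_map]
  -- evaluation of `ι_Λ(P · G)` for a polynomial `P ∈ ℤ[T]` and `G ∈ Λ`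
  have hevalmul : ∀ (P : ℤ[X]) (G : IwasawaAlgebra p),
      HasSum (fun k ↦ ι (PowerSeries.coeff k
          (iwasawaToPowerSeries p ((P.map (Int.castRingHom ℤ_[p]) : PowerSeries ℤ_[p]) * G))) *
            z ^ k)
        (P.eval₂ (algebraMap ℤ ℂ_[p]) z * ∑' k, ιZ (PowerSeries.coeff k G) * z ^ k) := by
    intro P G
    have hs : Summable fun k ↦ ιZ (PowerSeries.coeff k
        (((P.map (Int.castRingHom ℤ_[p]) : PowerSeries ℤ_[p]) * G))) * z ^ k :=
      summable_map_coeff_mul_pow ιZ (hbd _) hz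
    have h1 := hs.hasSum
    rw [tsum_map_coeff_mul_mul_pow ιZ (hbd _) (hbd _) hz,
      (hasSum_map_coeff_coe_mul_pow ιZ _ z).tsum_eq, Polynomial.eval₂_map,
      RingHom.ext_int (ιZ.comp (Int.castRingHom ℤ_[p])) (algebraMap ℤ ℂ_[p])] at h1
    refine h1.congr_fun fun k ↦ ?_
    rw [hcoe]
  -- the right-hand side evaluates to `ω_n(z) q(z) = 0`
  have hR : HasSum (fun k ↦ ι (PowerSeries.coeff k (iwasawaToPowerSeries p
      (((cyclotomicOmega p n).map (Int.castRingHom ℤ_[p]) : PowerSeries ℤ_[p]) * q))) * z ^ k)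
      0 := by
    have h1 := hevalmul (cyclotomicOmega p n) q
    have h0 : (cyclotomicOmega p n).eval₂ (algebraMap ℤ ℂ_[p]) z = 0 := by
      rw [cyclotomicOmega, eval₂_sub, eval₂_pow, eval₂_add, eval₂_X, eval₂_one, add_comm z 1, hzn,
        sub_self]
    rwa [h0, zero_mul] at h1
  -- the left-hand side evaluates to `p^m (θ(z) - ω(z) L(z))`
  have hθ : HasSum (fun k ↦ ι (PowerSeries.coeff k
      ((θ.map (algebraMap ℚ ℚ_[p]) : PowerSeries ℚ_[p]))) * z ^ k)
      (θ.eval₂ (algebraMap ℚ ℂ_[p]) z) := by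
    have h1 := hasSum_map_coeff_coe_mul_pow ι (θ.map (algebraMap ℚ ℚ_[p])) z
    rwa [Polynomial.eval₂_map, RingHom.ext_rat (ι.comp (algebraMap ℚ ℚ_[p])) (algebraMap ℚ ℂ_[p])]
      at h1
  have hL : HasSum (fun k ↦ ι (PowerSeries.coeff k
      ((PowerSeries.C ((p : ℚ_[p]) ^ m)) *
        ((θ.map (algebraMap ℚ ℚ_[p]) : PowerSeries ℚ_[p]) -
          iwasawaToPowerSeries p ((ω.map (Int.castRingHom ℤ_[p]) : PowerSeries ℤ_[p]) * L))))
        * z ^ k)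
      (ι ((p : ℚ_[p]) ^ m) * (θ.eval₂ (algebraMap ℚ ℂ_[p]) z -
        ω.eval₂ (algebraMap ℤ ℂ_[p]) z * ∑' k, ιZ (PowerSeries.coeff k L) * z ^ k)) := by
    have h1 := (hθ.sub (hevalmul ω L)).mul_left (ι ((p : ℚ_[p]) ^ m))
    refine h1.congr_fun fun k ↦ ?_
    simp only [PowerSeries.coeff_C_mul, map_mul, map_sub]
    ring
  -- compare the two evaluations of `p^m (θ - ω L) = ω_n q`
  have key : ∑' k, ι (PowerSeries.coeff k
      ((PowerSeries.C ((p : ℚ_[p]) ^ m)) *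
        ((θ.map (algebraMap ℚ ℚ_[p]) : PowerSeries ℚ_[p]) -
          iwasawaToPowerSeries p ((ω.map (Int.castRingHom ℤ_[p]) : PowerSeries ℤ_[p]) * L))))
        * z ^ k =
      ∑' k, ι (PowerSeries.coeff k (iwasawaToPowerSeries p
        (((cyclotomicOmega p n).map (Int.castRingHom ℤ_[p]) : PowerSeries ℤ_[p]) * q))) * z ^ k := by
    rw [hmq]
  rw [hL.tsum_eq, hR.tsum_eq, mul_eq_zero] at key
  have hpm : ι ((p : ℚ_[p]) ^ m) ≠ 0 := by
    rw [map_pow, map_natCast]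
    exact pow_ne_zero _ (Nat.cast_ne_zero.mpr (Fact.out : p.Prime).ne_zero)
  exact sub_eq_zero.mp (key.resolve_left hpm)

variable {N : ℕ} (f : CuspForm (Gamma0 N) 2)

/-- **The value of `θ_n` at a wild character is Birch's twisted symbol sum**: for a Dirichlet
character `χ` modulo `p^{n+e₀}` with values in `ℂ_p` which is even and of `p`-power order (a
character of `Γ = ℤ_p^×/μ_τ`), `θ_n(χ(γ) - 1) = ∑_{a mod p^{n+e₀}} χ(a) [a/p^{n+e₀}]⁺_f`
(`= ratTwistedSymbolSum f χ`): `(1 + T)^s ↦ χ(γ)^s = χ(η γ^s)` since `χ(η) = 1`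
(`apply_toZModPow_rootsOfUnity`), and `(η, s) ↦ η γ^s` is a bijection onto `(ℤ/p^{n+e₀})^×`
(`finsum_sum_classes_eq_sum_units`); non-units contribute `χ(a) = 0`
(Pollack 2003, proof of Prop. 6.9; Mazur–Tate–Teitelbaum 1986, §I.13).
[cite: Pollack2003, Prop. 6.9 (proof)] -/
theorem eval₂_mazurTateElement_eq_ratTwistedSymbolSum {n : ℕ}
    (χ : DirichletCharacter ℂ_[p] (p ^ (n + cyclotomicExponent p))) (heven : χ.Even)
    (hord : ∃ j : ℕ, orderOf χ = p ^ j) :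
    (mazurTateElement f p n).eval₂ (algebraMap ℚ ℂ_[p])
        (χ (cyclotomicGenerator p : ZMod (p ^ (n + cyclotomicExponent p))) - 1) =
      ratTwistedSymbolSum f χ := by
  classical
  have hp : p.Prime := Fact.out
  haveI := neZero_torsionOrder p
  haveI := Fintype.ofFinite (rootsOfUnity (torsionOrder p) ℤ_[p])
  haveI : NeZero (p ^ n) := ⟨pow_ne_zero _ hp.ne_zero⟩
  haveI : NeZero (p ^ (n + cyclotomicExponent p)) := ⟨pow_ne_zero _ hp.ne_zero⟩
  set g : ZMod (p ^ (n + cyclotomicExponent p)) → ℂ_[p] := fun b ↦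
    χ b * algebraMap ℚ ℂ_[p]
      (ratPlusSymbol f ((b.val : ℚ) / (p : ℚ) ^ (n + cyclotomicExponent p))) with hg
  -- evaluate the polynomial: `(X + 1)^s ↦ χ(γ)^s = χ(η γ^s)`
  have h1 : (mazurTateElement f p n).eval₂ (algebraMap ℚ ℂ_[p])
      (χ (cyclotomicGenerator p : ZMod (p ^ (n + cyclotomicExponent p))) - 1) =
      ∑ᶠ η : rootsOfUnity (torsionOrder p) ℤ_[p], ∑ s : ZMod (p ^ n),
        g (PadicInt.toZModPow (n + cyclotomicExponent p) ((η : ℤ_[p]ˣ) : ℤ_[p]) *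
          (cyclotomicGenerator p : ZMod (p ^ (n + cyclotomicExponent p))) ^ s.val) := by
    rw [mazurTateElement, finsum_eq_sum_of_fintype, finsum_eq_sum_of_fintype, eval₂_finsetSum]
    refine Finset.sum_congr rfl fun η _ ↦ ?_
    rw [eval₂_finsetSum]
    refine Finset.sum_congr rfl fun s _ ↦ ?_
    rw [eval₂_mul, eval₂_C, eval₂_pow, eval₂_add, eval₂_X, eval₂_one, sub_add_cancel, hg]
    dsimp only
    rw [map_mul, map_pow, apply_toZModPow_rootsOfUnity χ heven hord η, one_mul, mul_comm]
  rw [h1, finsum_sum_classes_eq_sum_units p n g, sum_units_eq_sum_filter_isUnit, Finset.sum_filter,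
    ratTwistedSymbolSum]
  refine Finset.sum_congr rfl fun a _ ↦ ?_
  split_ifs with ha
  · rw [hg]
    dsimp only
    rw [eq_ratCast, Nat.cast_pow]
  · rw [MulChar.map_nonunit χ ha, zero_mul]

/-- `ω_n^+(ζ - 1) ≠ 0` for `ζ ∈ ℂ_p` of order exactly `p^n` with `n` odd: the factors are
`Φ_{p^{2k}}(ζ)`, `2k ≤ n`, and `Φ_{p^{2k}}(ζ) = 0` would make `ζ` a primitive `p^{2k}`-th root of
unity, `2k ≠ n` (Pollack 2003, Lemma 4.7: `log_p^+(ζ_n - 1) ≠ 0` for `n` odd).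
[cite: Pollack2003, Lemma 4.7] -/
theorem eval₂_cyclotomicOmegaPlus_ne_zero {n : ℕ} (hn : Odd n) {ζ : ℂ_[p]}
    (hζ : IsPrimitiveRoot ζ (p ^ n)) :
    (cyclotomicOmegaPlus p n).eval₂ (algebraMap ℤ ℂ_[p]) (ζ - 1) ≠ 0 := by
  obtain ⟨j, rfl⟩ := hn
  rw [cyclotomicOmegaPlus, eval₂_finsetProd, Finset.prod_ne_zero_iff]
  intro k hk
  rw [Finset.mem_Icc] at hk
  rw [eval₂_comp, eval₂_add, eval₂_X, eval₂_one, sub_add_cancel, eval₂_eq_eval_map, map_cyclotomic]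
  intro hroot
  have hprim : IsPrimitiveRoot ζ (p ^ (2 * k)) :=
    (isRoot_cyclotomic_iff_charZero (pow_pos (Fact.out : p.Prime).pos _)).mp hroot
  have heq : p ^ (2 * k) = p ^ (2 * j + 1) := hprim.eq_orderOf.trans hζ.eq_orderOf.symm
  have := Nat.pow_right_injective (Fact.out : p.Prime).two_le heq
  omega

/-- `ω_n^-(ζ - 1) ≠ 0` for `ζ ∈ ℂ_p` of order exactly `p^n` with `n` even: the factors are
`Φ_{p^{2k-1}}(ζ)`, `2k - 1 ≤ n`, and `2k - 1 ≠ n` (Pollack 2003, Lemma 4.7: `log_p^-(ζ_n - 1) ≠ 0`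
for `n` even). [cite: Pollack2003, Lemma 4.7] -/
theorem eval₂_cyclotomicOmegaMinus_ne_zero {n : ℕ} (hn : Even n) {ζ : ℂ_[p]}
    (hζ : IsPrimitiveRoot ζ (p ^ n)) :
    (cyclotomicOmegaMinus p n).eval₂ (algebraMap ℤ ℂ_[p]) (ζ - 1) ≠ 0 := by
  obtain ⟨j, rfl⟩ := hn
  rw [cyclotomicOmegaMinus, eval₂_finsetProd, Finset.prod_ne_zero_iff]
  intro k hk
  rw [Finset.mem_Icc] at hk
  rw [eval₂_comp, eval₂_add, eval₂_X, eval₂_one, sub_add_cancel, eval₂_eq_eval_map, map_cyclotomic]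
  intro hroot
  have hprim : IsPrimitiveRoot ζ (p ^ (2 * k - 1)) :=
    (isRoot_cyclotomic_iff_charZero (pow_pos (Fact.out : p.Prime).pos _)).mp hroot
  have heq : p ^ (2 * k - 1) = p ^ (j + j) := hprim.eq_orderOf.trans hζ.eq_orderOf.symm
  have := Nat.pow_right_injective (Fact.out : p.Prime).two_le heq
  omega

end Evaluation

/-! ### The interpolation property of `L_p^±` at wild characters -/

section Interpolation

variable {W : WeierstrassCurve ℚ} [W.IsGloballyMinimal] {N : ℕ} [NeZero N]
  {f : CuspForm (Gamma0 N) 2} {p : ℕ} [Fact p.Prime]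

/-- **Interpolation property of Pollack's `L_p^±` at the wild characters**, from the fact
`pollack_exists_plusMinusPAdicLFunction` (Pollack 2003, proofs of Prop. 6.9 and Prop. 6.18):
under its hypotheses there are `L⁺, L⁻ ∈ Λ`, both `≠ 0`, such that for every `n ≥ 1` and every
primitive Dirichlet character `χ` of conductor `p^{n+e₀} = p^{n+1}` with values in `ℂ_p`, even and
of `p`-power order (equivalently: a character of `Γ = 1 + pℤ_p` of order `p^n`; then `ζ = χ(γ)` is
a primitive `p^n`-th root of unity, `orderOf_apply_cyclotomicGenerator`), Birch's sum
`∑_a χ(a) [a/p^{n+1}]⁺_f` (`= τ(χ) L(E, χ̄, 1)/Ω⁺`, `ratTwistedSymbolSum_mul_plusPeriod`) equals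
`(-1)^{⌊n/2⌋+1} ω_n^+(ζ - 1) · L⁺(ζ - 1)` if `n` is odd and `(-1)^{⌊n/2⌋+1} ω_n^-(ζ - 1) · L⁻(ζ - 1)`
if `n` is even, with the non-zero factors `ω_n^±(ζ - 1)` (`eval₂_cyclotomicOmegaPlus_ne_zero`,
`eval₂_cyclotomicOmegaMinus_ne_zero`); here `L(ζ - 1) = ∑_k l_k (ζ - 1)^k` in `ℂ_p`. In particular
`L(E, χ̄, 1) = 0` iff `ζ - 1` is one of the finitely many zeros of the Iwasawa function `L^±` in
the open unit disc (`MemIwasawaRat.finite_setOf_hasSum_zero`).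
[cite: Pollack2003, Prop. 6.9 (proof) and Prop. 6.18] -/
theorem pollack_exists_plusMinusPAdicLFunction.interpolation
    (h : pollack_exists_plusMinusPAdicLFunction (W := W) (f := f) (p := p)) (hp : p ≠ 2)
    (hf : IsNewformOf W f) (hgood : W.HasGoodReductionAtPrime p) (hap : W.frobeniusTrace p = 0) :
    ∃ Lplus Lminus : IwasawaAlgebra p, Lplus ≠ 0 ∧ Lminus ≠ 0 ∧
      ∀ (n : ℕ), 0 < n → ∀ χ : DirichletCharacter ℂ_[p] (p ^ (n + cyclotomicExponent p)),
        χ.IsPrimitive → χ.Even → (∃ j : ℕ, orderOf χ = p ^ j) →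
          (Odd n →
            (cyclotomicOmegaPlus p n).eval₂ (algebraMap ℤ ℂ_[p])
                (χ (cyclotomicGenerator p : ZMod (p ^ (n + cyclotomicExponent p))) - 1) ≠ 0 ∧
              ratTwistedSymbolSum f χ =
                (-1) ^ (n / 2 + 1) *
                  (cyclotomicOmegaPlus p n).eval₂ (algebraMap ℤ ℂ_[p])
                    (χ (cyclotomicGenerator p : ZMod (p ^ (n + cyclotomicExponent p))) - 1) *
                  ∑' k, ((algebraMap ℚ_[p] ℂ_[p]).comp (algebraMap ℤ_[p] ℚ_[p]))
                      (PowerSeries.coeff k Lplus) *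
                    (χ (cyclotomicGenerator p : ZMod (p ^ (n + cyclotomicExponent p))) - 1) ^ k) ∧
          (Even n →
            (cyclotomicOmegaMinus p n).eval₂ (algebraMap ℤ ℂ_[p])
                (χ (cyclotomicGenerator p : ZMod (p ^ (n + cyclotomicExponent p))) - 1) ≠ 0 ∧
              ratTwistedSymbolSum f χ =
                (-1) ^ (n / 2 + 1) *
                  (cyclotomicOmegaMinus p n).eval₂ (algebraMap ℤ ℂ_[p])
                    (χ (cyclotomicGenerator p : ZMod (p ^ (n + cyclotomicExponent p))) - 1) *
                  ∑' k, ((algebraMap ℚ_[p] ℂ_[p]).comp (algebraMap ℤ_[p] ℚ_[p]))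
                      (PowerSeries.coeff k Lminus) *
                    (χ (cyclotomicGenerator p : ZMod (p ^ (n + cyclotomicExponent p))) - 1) ^ k) := by
  obtain ⟨Lplus, Lminus, hLplus, hLminus, hodd, heven⟩ := h hp hf hgood hap
  refine ⟨Lplus, Lminus, hLplus, hLminus, fun n hn χ hχ hev hord ↦ ?_⟩
  set ζ : ℂ_[p] := χ (cyclotomicGenerator p : ZMod (p ^ (n + cyclotomicExponent p))) with hζdef
  -- `ζ = χ(γ)` is a primitive `p^n`-th root of unity, so `|ζ - 1| < 1` and `(1 + (ζ - 1))^{p^n} = 1`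
  have hordζ : orderOf ζ = p ^ n := by
    have h1 := orderOf_apply_cyclotomicGenerator (m := n + cyclotomicExponent p)
      (Nat.lt_add_of_pos_left hn) χ hχ hev hord
    rwa [Nat.add_sub_cancel] at h1
  have hprim : IsPrimitiveRoot ζ (p ^ n) := hordζ ▸ IsPrimitiveRoot.orderOf ζ
  have hpow : ζ ^ p ^ n = 1 := hordζ ▸ pow_orderOf_eq_one ζ
  have hz : ‖ζ - 1‖ < 1 := norm_sub_one_lt_one_of_pow_prime_pow_eq_one hpow
  have hzn : (1 + (ζ - 1)) ^ p ^ n = 1 := by rwa [add_sub_cancel]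
  have hθ := eval₂_mazurTateElement_eq_ratTwistedSymbolSum f χ hev hord
  refine ⟨fun ho ↦ ⟨eval₂_cyclotomicOmegaPlus_ne_zero ho hprim, ?_⟩,
    fun he ↦ ⟨eval₂_cyclotomicOmegaMinus_ne_zero he hprim, ?_⟩⟩
  · have h1 := (hodd n ho).eval₂_eq hz hzn
    rw [hθ, eval₂_mul, eval₂_pow, eval₂_neg, eval₂_one] at h1
    exact h1
  · have h1 := (heven n he).eval₂_eq hz hzn
    rw [hθ, eval₂_mul, eval₂_pow, eval₂_neg, eval₂_one] at h1
    exact h1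

end Interpolation

/-! ### Zeros of `L_p^±` at vanishing twists, and finiteness of the vanishing levels -/

section Zeros

variable {W : WeierstrassCurve ℚ} [W.IsGloballyMinimal] {N : ℕ} [NeZero N]
  {f : CuspForm (Gamma0 N) 2} {p : ℕ} [Fact p.Prime]

/-- **A vanishing wild twist is a zero of `L_p^±`** (Pollack 2003, proof of Prop. 6.9 / §6.3):
under the hypotheses of `pollack_exists_plusMinusPAdicLFunction` there are `L⁺, L⁻ ∈ Λ`, both
`≠ 0`, such that for `n ≥ 1` and `χ` a primitive character of conductor `p^{n+1}` with values in
`ℂ_p`, even and of `p`-power order, if Birch's sum `∑_a χ(a)[a/p^{n+1}]⁺_f` (`= τ(χ) L(E, χ̄, 1)/Ω⁺`)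
vanishes then `ζ - 1`, `ζ = χ(γ)`, is a zero of `L⁺` (if `n` is odd) resp. `L⁻` (if `n` is even):
`∑_k l_k (ζ - 1)^k = 0`. Immediate from `pollack_exists_plusMinusPAdicLFunction.interpolation`
(the factors `(-1)^{⌊n/2⌋+1} ω_n^±(ζ - 1)` are non-zero). [cite: Pollack2003, Prop. 6.9 (proof)] -/
theorem pollack_exists_plusMinusPAdicLFunction.hasSum_zero_of_ratTwistedSymbolSum_eq_zero
    (h : pollack_exists_plusMinusPAdicLFunction (W := W) (f := f) (p := p)) (hp : p ≠ 2)
    (hf : IsNewformOf W f) (hgood : W.HasGoodReductionAtPrime p) (hap : W.frobeniusTrace p = 0) :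
    ∃ Lplus Lminus : IwasawaAlgebra p, Lplus ≠ 0 ∧ Lminus ≠ 0 ∧
      ∀ (n : ℕ), 0 < n → ∀ χ : DirichletCharacter ℂ_[p] (p ^ (n + cyclotomicExponent p)),
        χ.IsPrimitive → χ.Even → (∃ j : ℕ, orderOf χ = p ^ j) → ratTwistedSymbolSum f χ = 0 →
          HasSum (fun k ↦ ((algebraMap ℚ_[p] ℂ_[p]).comp (algebraMap ℤ_[p] ℚ_[p]))
              (PowerSeries.coeff k (if Even n then Lminus else Lplus)) *
            (χ (cyclotomicGenerator p : ZMod (p ^ (n + cyclotomicExponent p))) - 1) ^ k) 0 := by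
  obtain ⟨Lplus, Lminus, hLplus, hLminus, hint⟩ :=
    pollack_exists_plusMinusPAdicLFunction.interpolation h hp hf hgood hap
  refine ⟨Lplus, Lminus, hLplus, hLminus, fun n hn χ hχ hev hord hzero ↦ ?_⟩
  set ζ : ℂ_[p] := χ (cyclotomicGenerator p : ZMod (p ^ (n + cyclotomicExponent p))) with hζdef
  have hordζ : orderOf ζ = p ^ n := by
    have h1 := orderOf_apply_cyclotomicGenerator (m := n + cyclotomicExponent p)
      (Nat.lt_add_of_pos_left hn) χ hχ hev hord
    rwa [Nat.add_sub_cancel] at h1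
  have hpow : ζ ^ p ^ n = 1 := hordζ ▸ pow_orderOf_eq_one ζ
  have hz : ‖ζ - 1‖ < 1 := norm_sub_one_lt_one_of_pow_prime_pow_eq_one hpow
  have hsign : ((-1 : ℂ_[p]) ^ (n / 2 + 1)) ≠ 0 := pow_ne_zero _ (neg_ne_zero.mpr one_ne_zero)
  have hsum : ∀ L : IwasawaAlgebra p, HasSum (fun k ↦
      ((algebraMap ℚ_[p] ℂ_[p]).comp (algebraMap ℤ_[p] ℚ_[p])) (PowerSeries.coeff k L) *
        (ζ - 1) ^ k)
      (∑' k, ((algebraMap ℚ_[p] ℂ_[p]).comp (algebraMap ℤ_[p] ℚ_[p])) (PowerSeries.coeff k L) *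
        (ζ - 1) ^ k) := fun L ↦
    (summable_map_coeff_mul_pow _ (norm_algebraMap_coeff_le_one L) hz).hasSum
  obtain ⟨hodd, heven⟩ := hint n hn χ hχ hev hord
  rcases Nat.even_or_odd n with he | ho
  · obtain ⟨hω, heq⟩ := heven he
    rw [hzero, eq_comm, mul_eq_zero, mul_eq_zero, or_iff_right hsign, or_iff_right hω] at heq
    rw [if_pos he]
    have h1 := hsum Lminus
    rwa [heq] at h1
  · obtain ⟨hω, heq⟩ := hodd ho
    rw [hzero, eq_comm, mul_eq_zero, mul_eq_zero, or_iff_right hsign, or_iff_right hω] at heq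
    rw [if_neg (Nat.not_even_iff_odd.mpr ho)]
    have h1 := hsum Lplus
    rwa [heq] at h1

/-- **Only finitely many levels carry a vanishing wild twist** (Pollack 2003, Cor. 5.11 with the
finiteness of the zeros of a non-zero Iwasawa function, §3 / Lemma 3.2; cf. Rohrlich, Thm. 5.10):
under the hypotheses of `pollack_exists_plusMinusPAdicLFunction`, the set of `n ≥ 1` for which
some primitive character `χ` of conductor `p^{n+1}` (values in `ℂ_p`, even, `p`-power order) has
`∑_a χ(a)[a/p^{n+1}]⁺_f = 0` is finite: such an `n` makes `χ(γ) - 1` a zero of `L⁺` or `L⁻` in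
the open unit disc (`…hasSum_zero_of_ratTwistedSymbolSum_eq_zero`), these zero sets are finite
(`MemIwasawaRat.finite_setOf_hasSum_zero`, `L^± ≠ 0`), and `n` is recovered from the zero as
`orderOf χ(γ) = p^n` (`orderOf_apply_cyclotomicGenerator`). [cite: Pollack2003, Cor. 5.11] -/
theorem pollack_exists_plusMinusPAdicLFunction.finite_setOf_exists_ratTwistedSymbolSum_eq_zero
    (h : pollack_exists_plusMinusPAdicLFunction (W := W) (f := f) (p := p)) (hp : p ≠ 2)
    (hf : IsNewformOf W f) (hgood : W.HasGoodReductionAtPrime p) (hap : W.frobeniusTrace p = 0) :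
    {n : ℕ | 0 < n ∧ ∃ χ : DirichletCharacter ℂ_[p] (p ^ (n + cyclotomicExponent p)),
      χ.IsPrimitive ∧ χ.Even ∧ (∃ j : ℕ, orderOf χ = p ^ j) ∧ ratTwistedSymbolSum f χ = 0}.Finite := by
  classical
  have hprime : p.Prime := Fact.out
  obtain ⟨Lplus, Lminus, hLplus, hLminus, hzero⟩ :=
    pollack_exists_plusMinusPAdicLFunction.hasSum_zero_of_ratTwistedSymbolSum_eq_zero h hp hf hgood hap
  -- the finite zero sets of `L⁺`, `L⁻` in the open unit disc
  set Z : IwasawaAlgebra p → Set ℂ_[p] := fun L ↦ {z : ℂ_[p] | ‖z‖ < 1 ∧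
    HasSum (fun k ↦ algebraMap ℚ_[p] ℂ_[p] (PowerSeries.coeff k (iwasawaToPowerSeries p L)) *
      z ^ k) 0} with hZ
  have hZfin : ∀ L : IwasawaAlgebra p, L ≠ 0 → (Z L).Finite := fun L hL ↦
    MemIwasawaRat.finite_setOf_hasSum_zero (memIwasawaRat_iwasawaToPowerSeries p L)
      (fun h0 ↦ hL (iwasawaToPowerSeries_injective p (by rw [h0, map_zero])))
  have hcoe : ∀ (L : IwasawaAlgebra p) (k : ℕ),
      algebraMap ℚ_[p] ℂ_[p] (PowerSeries.coeff k (iwasawaToPowerSeries p L)) =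
        ((algebraMap ℚ_[p] ℂ_[p]).comp (algebraMap ℤ_[p] ℚ_[p])) (PowerSeries.coeff k L) := by
    intro L k
    simp only [RingHom.comp_apply, iwasawaToPowerSeries, PowerSeries.coeff_map]
  -- the levels inject into the zero sets through `n ↦ p^n = orderOf (1 + z)`
  refine ((((hZfin Lplus hLplus).union (hZfin Lminus hLminus)).image
    fun z : ℂ_[p] ↦ orderOf (1 + z)).preimage
      ((Nat.pow_right_injective hprime.two_le).injOn.mono (Set.subset_univ _))).subset ?_
  rintro n ⟨hn, χ, hχ, hev, hord, hsum0⟩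
  set ζ : ℂ_[p] := χ (cyclotomicGenerator p : ZMod (p ^ (n + cyclotomicExponent p))) with hζdef
  have hordζ : orderOf ζ = p ^ n := by
    have h1 := orderOf_apply_cyclotomicGenerator (m := n + cyclotomicExponent p)
      (Nat.lt_add_of_pos_left hn) χ hχ hev hord
    rwa [Nat.add_sub_cancel] at h1
  have hpow : ζ ^ p ^ n = 1 := hordζ ▸ pow_orderOf_eq_one ζ
  have hz : ‖ζ - 1‖ < 1 := norm_sub_one_lt_one_of_pow_prime_pow_eq_one hpow
  have hmem : ζ - 1 ∈ Z Lplus ∪ Z Lminus := by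
    have h1 := hzero n hn χ hχ hev hord hsum0
    rcases Nat.even_or_odd n with he | ho
    · rw [if_pos he] at h1
      refine Or.inr ⟨hz, ?_⟩
      simpa only [hcoe] using h1
    · rw [if_neg (Nat.not_even_iff_odd.mpr ho)] at h1
      refine Or.inl ⟨hz, ?_⟩
      simpa only [hcoe] using h1
  refine ⟨ζ - 1, hmem, ?_⟩
  dsimp only
  rw [add_sub_cancel, hordζ]

end Zeros


end Literature.NumberTheory.EllipticCurves
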